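/-
Copyright (c) 2026 the pub-hodgecm-mathlib formalisation cell (harness21).  Prover seat hodgecm-mathlib-K2E3-p24 (g0), Track B «K2-LIT» ∕ h413
(`stmt-HodgeConjecture-24833`), line `K2_E3_EllipticInputs`, road (11-3-split-nsc), leaf (nsc-S-C′) `sig_K2E3GL3TwoBlockCuspidalSupportCharLocInt`,
brick (hInd-W): integrability of a `K × M × U` weight that is `L¹` in the `M`-variable on a compact box.  2026-09-04.
-/
import Mathlib.MeasureTheory.Integral.Prod
import Mathlib.MeasureTheory.Function.LocallyIntegrable
import HarnessLib

/-!
# K2_E3 road (h413), leaf (nsc-S-C′), brick (hInd-W) — integrability on `K × (M × U)` of functions dominated by `B · |Θ(m)|` and supported in a box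
# `K × S_M × S_U`, for `Θ` integrable on `S_M` (pure measure theory for the localisation step of van Dijk's induced character with an `L¹_loc` Levi character)

Cell `pub/hodgecm-mathlib` (D-0151), Track B, seat K2E3-p24 (g0) = hand of the hosted leaf (nsc-S-C′) (road owner K2E3-p11 (g6)).
`--supports stmt-HodgeConjecture-24833 --as helper`; THEOREMS ONLY (no definition ∕ instance ∕ notation ∕ named fact ∕ `sorry`); never imports `Cruxes/…/Lines`.
COUNT-NEUTRAL (pure measure theory; the `L¹` twin of the bounded-weight bookkeeping inside ★ (nsc-vD-gen) p858529).

THE MATHEMATICS ([Folland1999, §2.5 Thm. 2.37 (Fubini–Tonelli); §3.2]).  Three σ-finite measures `μ_K` (finite), `ν_M`, `μ_U`, a box `S_M × S_U` with `μ_U(S_U) < ∞`,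
and `Θ : M → ℂ` integrable on `S_M`.  Then `t ↦ Θ(t.2.1)` is integrable for `(μ_K ⊗ ν_M ⊗ μ_U)|_{K × S_M × S_U}` (Fubini: `∫ |Θ| ≤ μ_K(K)·μ_U(S_U)·∫_{S_M}|Θ|`),
and every a.e.-strongly measurable `H` with `|H(t)| ≤ B |Θ(t.2.1)|` supported in the box is integrable for `μ_K ⊗ ν_M ⊗ μ_U`; likewise on `M × U` for each
fixed `k`.  (In (hInd): `H(k,m,u) = f(k⁻¹muk)·Θ(m)` with `f` a bounded test function supported near `g`, `Θ` the `L¹_loc` character of the supercuspidal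
inducing datum on `M_c`.)
* `integrable_comp_fst_restrict_prod`, `integrable_comp_snd_fst_restrict_box` — `q ↦ Θ(q.1)` ∕ `t ↦ Θ(t.2.1)` are integrable on the boxes;
* **`integrable_of_norm_le_of_support_subset_box`**, `integrable_of_norm_le_of_support_subset_prod` — the dominated, box-supported `H` are integrable.

HONEST LABEL: HC_CM is proved only modulo the 7 printed citations (2 remaining named inputs: hLiu418 = stmt-HodgeConjecture-24832, h413 =
stmt-HodgeConjecture-24833) until rung 0 closes; count-neutral helper.

## References
* [Folland1999] G. B. Folland, *Real Analysis*, 2nd ed. (1999), §2.5 Thm. 2.37, §3.2.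
-/

set_option autoImplicit false
set_option linter.dupNamespace false

noncomputable section

open MeasureTheory MeasureTheory.Measure Set
open scoped ENNReal

namespace Summit.HodgeConjecture.HodgeConjecture.Cruxes.H413.K2E3KMUWeightIntegrable

variable {α β γ : Type*} [MeasurableSpace α] [MeasurableSpace β] [MeasurableSpace γ]
  (μK : Measure α) [IsFiniteMeasure μK] (νM : Measure β) [SFinite νM] (μU : Measure γ) [SFinite μU]

/-- `q ↦ Θ(q.1)` is integrable for `(ν_M ⊗ μ_U)|_{S_M × S_U}` when `Θ ∈ L¹(S_M)` and `μ_U(S_U) < ∞` (Fubini). [cite: Folland1999, §2.5 Thm. 2.37] -/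
theorem integrable_comp_fst_restrict_prod {SM : Set β} {SU : Set γ} (hSU : μU SU ≠ ∞) {Θ : β → ℂ} (hΘ : IntegrableOn Θ SM νM) :
    Integrable (fun q : β × γ => Θ q.1) ((νM.prod μU).restrict (SM ×ˢ SU)) := by
  haveI : IsFiniteMeasure (μU.restrict SU) := ⟨by rw [Measure.restrict_apply_univ]; exact hSU.lt_top⟩
  rw [← Measure.prod_restrict]
  exact hΘ.comp_fst (μU.restrict SU)

/-- `t ↦ Θ(t.2.1)` is integrable for `(μ_K ⊗ ν_M ⊗ μ_U)|_{K × S_M × S_U}` when `μ_K` is finite, `Θ ∈ L¹(S_M)` and `μ_U(S_U) < ∞` (Fubini).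
[cite: Folland1999, §2.5 Thm. 2.37] -/
theorem integrable_comp_snd_fst_restrict_box {SM : Set β} {SU : Set γ} (hSU : μU SU ≠ ∞) {Θ : β → ℂ} (hΘ : IntegrableOn Θ SM νM) :
    Integrable (fun t : α × (β × γ) => Θ t.2.1) ((μK.prod (νM.prod μU)).restrict ((Set.univ : Set α) ×ˢ (SM ×ˢ SU))) := by
  haveI : IsFiniteMeasure (μU.restrict SU) := ⟨by rw [Measure.restrict_apply_univ]; exact hSU.lt_top⟩
  rw [← Measure.prod_restrict, Measure.restrict_univ]
  exact (integrable_comp_fst_restrict_prod νM μU hSU hΘ).comp_snd μK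

/-- **A box-supported function dominated by `B·|Θ(t.2.1)|` is integrable for `μ_K ⊗ ν_M ⊗ μ_U`** (`μ_K` finite, `Θ ∈ L¹(S_M)`, `μ_U(S_U) < ∞`).
[cite: Folland1999, §2.5 Thm. 2.37] -/
theorem integrable_of_norm_le_of_support_subset_box {SM : Set β} {SU : Set γ} (hSU : μU SU ≠ ∞) {Θ : β → ℂ} (hΘ : IntegrableOn Θ SM νM)
    {H : α × (β × γ) → ℂ} (hHm : AEStronglyMeasurable H (μK.prod (νM.prod μU))) {B : ℝ} (hB : ∀ t, ‖H t‖ ≤ B * ‖Θ t.2.1‖)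
    (hsupp : Function.support H ⊆ (Set.univ : Set α) ×ˢ (SM ×ˢ SU)) :
    Integrable H (μK.prod (νM.prod μU)) := by
  rw [← integrableOn_iff_integrable_of_support_subset hsupp, IntegrableOn]
  exact Integrable.mono' (((integrable_comp_snd_fst_restrict_box μK νM μU hSU hΘ).norm).const_mul B) hHm.restrict
    (Filter.Eventually.of_forall hB)

/-- The `M × U` twin: a function on `M × U` supported in `S_M × S_U` and dominated by `B·|Θ(q.1)|` is integrable for `ν_M ⊗ μ_U`. [cite: Folland1999, §2.5 Thm. 2.37] -/
theorem integrable_of_norm_le_of_support_subset_prod {SM : Set β} {SU : Set γ} (hSU : μU SU ≠ ∞) {Θ : β → ℂ} (hΘ : IntegrableOn Θ SM νM)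
    {H : β × γ → ℂ} (hHm : AEStronglyMeasurable H (νM.prod μU)) {B : ℝ} (hB : ∀ q, ‖H q‖ ≤ B * ‖Θ q.1‖)
    (hsupp : Function.support H ⊆ SM ×ˢ SU) :
    Integrable H (νM.prod μU) := by
  rw [← integrableOn_iff_integrable_of_support_subset hsupp, IntegrableOn]
  exact Integrable.mono' (((integrable_comp_fst_restrict_prod νM μU hSU hΘ).norm).const_mul B) hHm.restrict (Filter.Eventually.of_forall hB)

end Summit.HodgeConjecture.HodgeConjecture.Cruxes.H413.K2E3KMUWeightIntegrable

end
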